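import Summits.BirchSwinnertonDyer.BirchSwinnertonDyer.Theorems.AlignedTransportAtTwoMainConjectureOfRankZeroBSDAtTwoFineRoadDiscriminantSign
import Literature.NumberTheory.GaloisRepresentations.OddAbsolutelyIrreducibleProofs
import HarnessLib

/-!
# The image of `Gal(ℚ̄/ℚ_∞)` in `Aut(E[2]) ≅ S₃`: complex conjugation lies in `ker κ` for the CYCLOTOMIC `ℤ_p`-extension, so on the
# `Δ < 0` half-cell `Gal(ℚ̄/ℚ_∞)` contains a TRANSPOSITION; on the whole seed cell (irreducible `E[2]`, `p ≠ 3`) it contains a `3`-CYCLE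

Cell `bsd-f1-sign2`, WIDTH-5 attach seat `bsd-line-att-p5` (gen 7) on line `birth` of crux C2 stmt-BirchSwinnertonDyer-22298
`MainConjectureOfRankZeroBSDAtTwo` (route `AlignedTransportAtTwo`); sequel of `…FineRoadDiscriminantSign` (att-p5 g7). A
`--supports 22298 --as helper` file. HONEST FRAMING: THEOREMS ONLY — no definition, no named fact, no `sorry`; C2-NEUTRAL; BSD is NOT
proved by any of this.

WHY. The counting lemmas of the att-p3 lineage for road (b″) (`PerfectDescent.natCard_equivariant_S3_bounds`,
`…natCard_equivariant_eq_of_no_transposition`, `KleinCountingTransfer.finite_equivariant_iff_…_S3_of_transfer` /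
`…_of_no_transposition_of_transfer`) split according to the image `G_∞` of `Q = Gal(ℚ̄/ℚ_∞) = ker κ` in `Aut(W[2]) ≅ S₃`: they need a
fixed-point-free `σ ∈ Q` (a `3`-cycle) and, in the `S₃` case, a `τ ∈ Q` fixing a non-zero `m₀` but not everything (a transposition).
The lead's census (att-p5 g6 NOT-DONE (iii)) asked which case occurs. This file answers in the kernel:

* §1 (pure group theory on a Klein four-group `M` with a `Q`-action) `exists_fpf_mem_of_forall_exists_smul_ne`: a subgroup with no
  common non-zero fixed vector contains a fixed-point-free element (two transpositions with different fixed points compose to a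
  `3`-cycle); `exists_ne_zero_smul_pow_three_eq`: every CUBE fixes a non-zero vector; `exists_fpf_mem_of_cube`: if `M^Q = 0` and every
  element of `Q` is a cube times an element of the normal subgroup `N`, then `N` contains a fixed-point-free element.
* §2 `mem_kerSubgroup_of_isComplexConjugation`: **for the CYCLOTOMIC `ℤ_p`-extension of any field with a real embedding, every complex
  conjugation lies in `ker κ = Gal(K̄/K_∞)`** (`χ_p(c) = −1` is torsion in `ℤ_pˣ`; `K_∞^{cyc}` is real at every real place).
* §3 `exists_pow_three_inv_mul_mem_kerSubgroup`: for `p ≠ 3` every element of `Γ_K` is a cube modulo `ker κ` (`3 ∈ ℤ_pˣ`).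
* §4 elliptic curves: `exists_smul_ne_of_irreducible` (irreducible `E[2]` has no non-zero `Γ_K`-fixed vector);
  **`exists_fpf_mem_kerSubgroup_of_irreducible`** (any `ℤ_p`-extension, `p ≠ 3`, irreducible `E[2]`: `ker κ` contains an element acting
  on `E[2]` without non-zero fixed point — the image of `Gal(K̄/K_∞)` contains `A₃`);
  **`exists_transposition_mem_kerSubgroup_of_Δ_neg`** (`E/ℚ`, `Δ_E < 0`, cyclotomic `κ`, any `p`: `ker κ` contains an element acting as a
  transposition); **`exists_S3_data_kerSubgroup_of_Δ_neg`**: on the `Δ < 0` half of the seed cell of crux C2 (`p = 2`, no rational point of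
  order `2`) `Gal(ℚ̄/ℚ_∞)` supplies BOTH data `(σ, τ, m₀)` of the `S₃` counting lemma — `G_∞ = S₃` there; on `Δ > 0` complex conjugation is
  in `ker κ` but acts trivially (`G_∞ ∈ {C₃, S₃}` is then decided by whether `√Δ ∈ ℚ_∞`, i.e. `Δ ∈ 2ℚ²`, not treated here).

References: J.-P. Serre, *Abelian ℓ-adic representations* (1968) I §1.2 (`χ_ℓ(c) = −1`); L. Washington, *Introduction to Cyclotomic
Fields* §13.1; J.-P. Serre, Invent. Math. 15 (1972) §5.3 (`GL₂(𝔽₂) ≅ S₃`); J. H. Silverman, *AEC* III.1; the crux workfiles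
`PERFECT-DESCENT.md` §3 (iii) and `RELAXED-COEFFICIENTS-att-p5.md`.
-/

set_option autoImplicit false
-- the Theorems namespace of this sub repeats the summit name by design (D-0017 nested layout)
set_option linter.dupNamespace false

noncomputable section

open scoped Classical

namespace Summit.BirchSwinnertonDyer.BirchSwinnertonDyer.Theorems.AlignedTransportAtTwoFineRoad.TowerImage

open WeierstrassCurve Field Literature.NumberTheory.EllipticCurves Literature.NumberTheory.GaloisRepresentations
  Literature.NumberTheory.EllipticCurves.Rank1Residual Literature.NumberTheory.EllipticCurves.Greenberg1999
  Summit.BirchSwinnertonDyer.BirchSwinnertonDyer.Theorems.MultTransportAtTwo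
  Summit.BirchSwinnertonDyer.BirchSwinnertonDyer.Theorems.AlignedTransportAtTwoFineRoad
  Summit.BirchSwinnertonDyer.BirchSwinnertonDyer.Theorems.AlignedTransportAtTwoFineRoad.PerfectDescent
  Summit.BirchSwinnertonDyer.BirchSwinnertonDyer.Theorems.AlignedTransportAtTwoFineRoad.KleinRigidity

universe u

/-! ## §1 Pure group theory: fixed-point-free elements in subgroups acting on a Klein four-group -/

section Klein

variable {Q : Type*} [Group Q] {M : Type*} [AddCommGroup M] [DistribMulAction Q M]

/-- **A subgroup `S ≤ Q` with no common non-zero fixed vector on the Klein four-group `M` contains a FIXED-POINT-FREE element.**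
If no element of `S` were fixed-point-free, every element of `S` would act trivially or as a transposition (fixing exactly one
non-zero vector); two transpositions `t_a ≠ t_b` in `S` compose to the `3`-cycle `t_a t_b ∈ S` — so all transpositions of `S` fix the
same vector, which is then `S`-fixed. [cite: Serre1972, §5.3 (`GL₂(𝔽₂) ≅ S₃`)] -/
theorem exists_fpf_mem_of_forall_exists_smul_ne (h4 : Nat.card M = 4) (h2 : ∀ m : M, m + m = 0) (S : Subgroup Q)
    (hS : ∀ m : M, m ≠ 0 → ∃ s ∈ S, s • m ≠ m) : ∃ s ∈ S, ∀ m : M, s • m = m → m = 0 := by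
  by_contra! hno
  -- `hno : ∀ s ∈ S, ∃ m, s • m = m ∧ m ≠ 0`
  obtain ⟨m₁, hm₁⟩ := klein_exists_ne_zero h4
  obtain ⟨g₁, hg₁S, hg₁m₁⟩ := hS m₁ hm₁
  obtain ⟨a, hg₁a, ha⟩ := hno g₁ hg₁S
  obtain ⟨g, hgS, hga⟩ := hS a ha
  obtain ⟨b, hgb, hb⟩ := hno g hgS
  have hab : a ≠ b := fun h ↦ hga (by rw [h, hgb])
  have hg₁b : g₁ • b ≠ b := fun h ↦ hg₁m₁ (smul_eq_self_of_generators h4 h2 ha hb hab hg₁a h m₁)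
  have e₁ : g₁ • b = a + b := smul_eq_add_of_fixed_of_ne h4 h2 ha hg₁a hg₁b
  have e₂ : g • a = b + a := smul_eq_add_of_fixed_of_ne h4 h2 hb hgb hga
  have haba : a + b + a = b := by rw [add_comm a b, add_assoc, h2, add_zero]
  have habb : a + b + b = a := by rw [add_assoc, h2, add_zero]
  -- `g₁ g ∈ S` is a `3`-cycle: contradiction
  obtain ⟨c, hc, hc0⟩ := hno (g₁ * g) (S.mul_mem hg₁S hgS)
  rcases klein_cases h4 h2 ha hb hab c with rfl | rfl | rfl | rfl
  · exact hc0 rfl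
  · -- `(g₁ g) a = g₁ (b + a) = (a + b) + a = b`
    rw [mul_smul, e₂, smul_add, e₁, hg₁a, haba] at hc
    exact hab hc.symm
  · -- `(g₁ g) b = g₁ b = a + b`
    rw [mul_smul, hgb, e₁] at hc
    exact ha (by rw [← habb, hc, h2])
  · -- `(g₁ g) (a + b) = g₁ (b + a + b) = g₁ a = a`
    rw [mul_smul, smul_add, e₂, hgb, add_comm b a, habb, hg₁a] at hc
    have h : a + a = a + (a + b) := congrArg (fun x ↦ a + x) hc
    rw [h2, ← add_assoc, h2, zero_add] at h
    exact hb h.symm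

/-- **Every CUBE fixes a non-zero vector of the Klein four-group**: if `y` fixes a non-zero `w` so does `y³`; otherwise `y` is
fixed-point-free and `y³ = 1` (`KleinRigidity.smul_smul_smul_eq_self_of_fpf`). (In `S₃`: cubes are the identity and the
transpositions.) [cite: Serre1972, §5.3] -/
theorem exists_ne_zero_smul_pow_three_eq (h4 : Nat.card M = 4) (h2 : ∀ m : M, m + m = 0) (y : Q) :
    ∃ w : M, w ≠ 0 ∧ (y ^ 3) • w = w := by
  by_cases hy : ∀ m : M, y • m = m → m = 0
  · obtain ⟨w, hw⟩ := klein_exists_ne_zero h4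
    exact ⟨w, hw, by rw [pow_three, mul_smul, mul_smul, KleinRigidity.smul_smul_smul_eq_self_of_fpf h4 h2 hy w]⟩
  · push Not at hy
    obtain ⟨w, hyw, hw⟩ := hy
    exact ⟨w, hw, by rw [pow_three, mul_smul, mul_smul, hyw, hyw, hyw]⟩

/-- **A normal subgroup fixing one non-zero vector, next to a fixed-point-free element, acts trivially**: if `N ⊴ Q` fixes
`m₀ ≠ 0` and `g ∈ Q` is fixed-point-free, then `N` also fixes `g m₀` (`n g m₀ = g (g⁻¹ n g) m₀`), and `m₀, g m₀` generate `M`.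
[cite: Serre1972, §5.3] -/
theorem forall_smul_eq_of_normal_of_fpf (h4 : Nat.card M = 4) (h2 : ∀ m : M, m + m = 0) (N : Subgroup Q) [hN : N.Normal]
    {g : Q} (hg : ∀ m : M, g • m = m → m = 0) {m₀ : M} (hm₀ : m₀ ≠ 0) (hfix : ∀ n ∈ N, n • m₀ = m₀) :
    ∀ n ∈ N, ∀ m : M, n • m = m := by
  intro n hn
  have hgm₀ : g • m₀ ≠ 0 := fun h ↦ hm₀ ((smul_eq_zero_iff_eq g).mp h)
  have hne : m₀ ≠ g • m₀ := fun h ↦ hm₀ (hg m₀ h.symm)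
  have h' : n • g • m₀ = g • m₀ := by
    have hmem : g⁻¹ * n * g⁻¹⁻¹ ∈ N := hN.conj_mem n hn g⁻¹
    rw [inv_inv] at hmem
    calc n • g • m₀ = g • (g⁻¹ * n * g) • m₀ := by rw [mul_smul, mul_smul, smul_inv_smul]
      _ = g • m₀ := by rw [hfix _ hmem]
  exact smul_eq_self_of_generators h4 h2 hm₀ hgm₀ hne (hfix n hn) h'

/-- **Fixed-point-free elements in a normal subgroup of "cube-divisible" index.** Let `Q` act on the Klein four-group `M` with
`M^Q = 0` (no non-zero common fixed vector) and let `N ⊴ Q` be such that every `q ∈ Q` is `y³ n` with `n ∈ N` (e.g. `Q/N ≅ ℤ_p`,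
`p ≠ 3`). Then `N` contains a fixed-point-free element: otherwise `N` fixes some `m₀ ≠ 0` (§1), hence acts trivially (there is a
fixed-point-free `g ∈ Q`), so `g = y³ n` acts as the cube `y³`, which fixes a non-zero vector — contradiction. (The image of `N` in
`Aut(M) ≅ S₃` contains `A₃`.) [cite: Serre1972, §5.3] -/
theorem exists_fpf_mem_of_cube (h4 : Nat.card M = 4) (h2 : ∀ m : M, m + m = 0) (N : Subgroup Q) [N.Normal]
    (hirr : ∀ m : M, m ≠ 0 → ∃ q : Q, q • m ≠ m) (hdiv : ∀ q : Q, ∃ y : Q, (y ^ 3)⁻¹ * q ∈ N) :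
    ∃ s ∈ N, ∀ m : M, s • m = m → m = 0 := by
  obtain ⟨g, -, hg⟩ := exists_fpf_mem_of_forall_exists_smul_ne h4 h2 (⊤ : Subgroup Q)
    (fun m hm ↦ by obtain ⟨q, hq⟩ := hirr m hm; exact ⟨q, Subgroup.mem_top q, hq⟩)
  by_contra hno
  have hfixN : ∃ m : M, m ≠ 0 ∧ ∀ n ∈ N, n • m = m := by
    by_contra! h
    exact hno (exists_fpf_mem_of_forall_exists_smul_ne h4 h2 N h)
  obtain ⟨m₀, hm₀, hfix⟩ := hfixN
  have htriv := forall_smul_eq_of_normal_of_fpf h4 h2 N hg hm₀ hfix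
  obtain ⟨y, hy⟩ := hdiv g
  obtain ⟨w, hw, hyw⟩ := exists_ne_zero_smul_pow_three_eq h4 h2 y
  have hgw : g • w = w := by
    have e : g = y ^ 3 * ((y ^ 3)⁻¹ * g) := by rw [mul_inv_cancel_left]
    rw [e, mul_smul, htriv _ hy w, hyw]
  exact hw (hg w hgw)

end Klein

/-! ## §2 Complex conjugation lies in `ker κ` for the cyclotomic `ℤ_p`-extension -/

section Cyclotomic

variable {K : Type u} [Field K] {p : ℕ} [Fact p.Prime] (κ : ZpExtension K p)

/-- **Complex conjugation lies in `Gal(K̄/K_∞^{cyc})`**: for the CYCLOTOMIC `ℤ_p`-extension `κ` of a field `K` (`ker κ = χ_p⁻¹(μ(ℤ_p))`)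
and a complex conjugation `c` attached to any real embedding `φ : K → ℝ`, `c ∈ ker κ` — because `χ_p(c) = −1`
(`GaloisRep.cyclotomicCharacter_of_isComplexConjugation`) is torsion. Equivalently `K_∞^{cyc}` is fixed by `c`: the cyclotomic
`ℤ_p`-extension of a number field is real at every real place. [cite: SerreAbelianLadic1968, Ch. I §1.2] [cite: Washington1997, §13.1] -/
theorem mem_kerSubgroup_of_isComplexConjugation (hκ : κ.IsCyclotomic) {φ : K →+* ℝ} {c : absoluteGaloisGroup K}
    (hc : IsComplexConjugation φ c) : c ∈ κ.kerSubgroup := by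
  have hker : κ.kerSubgroup = _ := hκ
  rw [hker, Subgroup.mem_comap, CommGroup.mem_torsion]
  have h1 : ((GaloisRep.cyclotomicCharacter K p c : ℤ_[p]ˣ) : ℤ_[p]) = -1 :=
    GaloisRep.cyclotomicCharacter_of_isComplexConjugation p hc
  have h2 : GaloisRep.cyclotomicCharacter K p c = -1 := Units.ext (by rw [h1, Units.val_neg, Units.val_one])
  refine isOfFinOrder_iff_pow_eq_one.mpr ⟨2, two_pos, ?_⟩
  change (GaloisRep.cyclotomicCharacter K p c) ^ 2 = 1
  rw [h2, neg_one_sq]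

/-- **For `p ≠ 3` every element of `Γ_K` is a cube modulo `ker κ`** (any `ℤ_p`-extension `κ`): `3 ∈ ℤ_pˣ`, so `κ(q) = κ(y)³` for some
`y` (surjectivity of `κ`), i.e. `y⁻³ q ∈ ker κ`. [cite: Washington1997, §13.1] -/
theorem exists_pow_three_inv_mul_mem_kerSubgroup (hp3 : p ≠ 3) (q : absoluteGaloisGroup K) :
    ∃ y : absoluteGaloisGroup K, (y ^ 3)⁻¹ * q ∈ κ.kerSubgroup := by
  have hcop : p.Coprime 3 := (Nat.coprime_primes Fact.out Nat.prime_three).mpr hp3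
  have hu : IsUnit ((3 : ℕ) : ℤ_[p]) := PadicInt.isUnit_iff.mpr (PadicInt.norm_natCast_eq_one_iff.mpr hcop)
  obtain ⟨u, hu⟩ := hu
  have hu3 : (u : ℤ_[p]) = 3 := by rw [hu, Nat.cast_ofNat]
  set x : ℤ_[p] := Multiplicative.toAdd (κ q) with hx
  obtain ⟨y, hy⟩ := κ.surjective (Multiplicative.ofAdd (↑u⁻¹ * x))
  have hy' : κ y = Multiplicative.ofAdd (↑u⁻¹ * x) := hy
  have h3 : κ y ^ 3 = κ q := by
    rw [hy', ← ofAdd_nsmul, nsmul_eq_mul, Nat.cast_ofNat, ← hu3, ← mul_assoc, Units.mul_inv, one_mul, hx, ofAdd_toAdd]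
  refine ⟨y, ?_⟩
  rw [ZpExtension.mem_kerSubgroup, map_mul, map_inv, map_pow, h3, inv_mul_cancel]

end Cyclotomic

/-! ## §3 Elliptic curves: `3`-cycles and transpositions inside `Gal(K̄/K_∞)` -/

section Elliptic

variable {K : Type} [Field K] (W : WeierstrassCurve K) [W.IsElliptic]

/-- **Irreducible `E[2]` has no non-zero `Γ_K`-fixed vector** (`2 ≠ 0` in `K`): the line `{0, v}` through a fixed `v ≠ 0` is a
`Γ_K`-stable subgroup of order `2 ∉ {1, 4}`. [cite: SilvermanAEC2009, III.§7 and Cor. III.6.4(b)] -/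
theorem exists_smul_ne_of_irreducible (hK : (2 : K) ≠ 0) (hirr : W.HasIrreducibleModPGaloisRep 2)
    (v : W.geomTorsion 2) (hv : v ≠ 0) : ∃ σ : absoluteGaloisGroup K, σ • v ≠ v := by
  by_contra! hfix
  have h2v : 2 • v = 0 := by
    rw [two_nsmul]
    apply Subtype.ext
    have hv2 := (WeierstrassCurve.mem_geomTorsion_iff W 2 (v : geomPoints W)).mp v.2
    rwa [two_zsmul] at hv2
  have hord : addOrderOf v = 2 := addOrderOf_eq_prime h2v hv
  let H : AddSubgroup (W.geomTorsion ((2 : ℕ) : ℤ)) := AddSubgroup.zmultiples v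
  have hstab : ∀ σ : absoluteGaloisGroup K, ∀ P ∈ H, σ • P ∈ H := by
    rintro σ P ⟨k, rfl⟩
    refine ⟨k, ?_⟩
    change k • v = σ • k • v
    rw [smul_comm σ k v, hfix σ]
  rcases hirr H hstab with hbot | htop
  · exact hv ((AddSubgroup.eq_bot_iff_forall _).mp hbot v (AddSubgroup.mem_zmultiples v))
  · have hc : Nat.card H = Nat.card (W.geomTorsion ((2 : ℕ) : ℤ)) := by
      rw [htop, AddSubgroup.card_top]
    have h4 : Nat.card (W.geomTorsion ((2 : ℕ) : ℤ)) = 4 := natCard_geomTorsion_two_of_two_ne_zero W hK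
    rw [h4, Nat.card_zmultiples, hord] at hc
    omega

/-- **`Gal(K̄/K_∞)` contains a `3`-CYCLE on `E[2]`**: for any `ℤ_p`-extension `κ` of a field `K` with `2 ≠ 0`, `p ≠ 3`, and an elliptic
`E/K` with IRREDUCIBLE `E[2]`, some `σ ∈ ker κ` acts on `E[2]` without non-zero fixed point — the image of `Gal(K̄/K_∞)` in
`Aut(E[2]) ≅ S₃` contains `A₃` (§1 `exists_fpf_mem_of_cube` with §2 `exists_pow_three_inv_mul_mem_kerSubgroup`). This is the datum `σ` of
BOTH counting lemmas of the att-p3 lineage (`PerfectDescent.natCard_equivariant_S3_bounds`, `…_eq_of_no_transposition`) for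
`Q = Gal(ℚ̄/ℚ_∞)` on the seed cell of crux C2. (False for `p = 3`: `ℚ(E[2])` can be the cubic subfield of `ℚ(ζ₉) ⊂ ℚ_∞^{(3)}`.)
[cite: Serre1972, §5.3] [cite: Washington1997, §13.1] -/
theorem exists_fpf_mem_kerSubgroup_of_irreducible {p : ℕ} [Fact p.Prime] (κ : ZpExtension K p) (hp3 : p ≠ 3)
    (hK : (2 : K) ≠ 0) (hirr : W.HasIrreducibleModPGaloisRep 2) :
    ∃ σ ∈ κ.kerSubgroup, ∀ v : W.geomTorsion 2, σ • v = v → v = 0 := by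
  haveI : κ.kerSubgroup.Normal := by rw [ZpExtension.kerSubgroup]; infer_instance
  -- `P + P = 0` on `E[2]` (the `ℚ`-case is `MultTransportAtTwo.add_self_geomTorsion_two`)
  have h2 : ∀ P : W.geomTorsion 2, P + P = 0 := fun P ↦ Subtype.ext (by
    have hP := (WeierstrassCurve.mem_geomTorsion_iff W 2 (P : geomPoints W)).mp P.2
    rwa [two_zsmul] at hP)
  exact exists_fpf_mem_of_cube (natCard_geomTorsion_two_of_two_ne_zero W hK) h2 κ.kerSubgroup
    (fun m hm ↦ exists_smul_ne_of_irreducible W hK hirr m hm) (exists_pow_three_inv_mul_mem_kerSubgroup κ hp3)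

end Elliptic

section Rat

variable (W : WeierstrassCurve ℚ) [W.IsElliptic] {p : ℕ} [Fact p.Prime] (κ : ZpExtension ℚ p)

/-- **`Δ_E < 0`: `Gal(ℚ̄/ℚ_∞^{cyc})` contains a TRANSPOSITION on `E[2]`** (any prime `p`, cyclotomic `κ`): a complex conjugation `τ = c₀`
lies in `ker κ` (§2) and, since `Δ_E < 0`, fixes a non-zero `m₀ ∈ E[2]` while moving some `v`
(`DiscriminantSign.exists_transposition_of_Δ_neg`). For `p = 2` this is the datum `(τ, m₀)` of the `S₃` counting lemma
`PerfectDescent.natCard_equivariant_S3_bounds` with `Q = Gal(ℚ̄/ℚ_∞)`: on the `Δ < 0` half-cell `G_∞ = Gal(ℚ_∞(W[2])/ℚ_∞)` is NOT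
contained in `A₃`. [cite: SilvermanAEC2009, III.1] [cite: SerreAbelianLadic1968, Ch. I §1.2] -/
theorem exists_transposition_mem_kerSubgroup_of_Δ_neg (hΔ : W.Δ < 0) (hκ : κ.IsCyclotomic) :
    ∃ τ ∈ κ.kerSubgroup, ∃ m₀ v : W.geomTorsion 2, m₀ ≠ 0 ∧ τ • m₀ = m₀ ∧ τ • v ≠ v := by
  obtain ⟨c₀, hc₀⟩ := exists_isComplexConjugation (Rat.castHom ℝ)
  exact ⟨c₀, mem_kerSubgroup_of_isComplexConjugation κ hκ hc₀, DiscriminantSign.exists_transposition_of_Δ_neg W hΔ hc₀⟩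

/-- **`Δ_E > 0`: complex conjugation lies in `Gal(ℚ̄/ℚ_∞^{cyc}(E[2]))`** — it is in `ker κ` (§2) AND fixes `E[2]` pointwise
(`DiscriminantSign.Δ_pos_iff_forall_smul_eq`), so it gives no information on `G_∞`; whether `G_∞ = C₃` or `S₃` on the `Δ > 0`
half-cell is decided by `√Δ ∈ ℚ_∞`, not treated here. [cite: SilvermanAEC2009, III.1] [cite: SerreAbelianLadic1968, Ch. I §1.2] -/
theorem mem_kerSubgroup_and_forall_smul_eq_of_Δ_pos (hΔ : 0 < W.Δ) (hκ : κ.IsCyclotomic) {c₀ : absoluteGaloisGroup ℚ}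
    (hc₀ : IsComplexConjugation (Rat.castHom ℝ) c₀) :
    c₀ ∈ κ.kerSubgroup ∧ ∀ v : W.geomTorsion 2, c₀ • v = v :=
  ⟨mem_kerSubgroup_of_isComplexConjugation κ hκ hc₀, (DiscriminantSign.Δ_pos_iff_forall_smul_eq W hc₀).mp hΔ⟩

/-- **`Gal(ℚ̄/ℚ_∞)` contains a `3`-cycle on `E[2]` for every `E/ℚ` without rational point of order `2`** (any `ℤ_p`-extension,
`p ≠ 3`; the cell binder `∀ x, ¬ HasRationalTwoTorsionX W x` of route `AlignedTransportAtTwo` gives irreducibility,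
`AlignedTransportAtTwoSeed.irr_two_of_forall_not_hasRationalTwoTorsionX`). [cite: Serre1972, §5.3] [cite: SilvermanAEC2009, III.2.3] -/
theorem exists_fpf_mem_kerSubgroup_of_forall_not_hasRationalTwoTorsionX (hp3 : p ≠ 3)
    (ht : ∀ x : ℚ, ¬ HasRationalTwoTorsionX W x) :
    ∃ σ ∈ κ.kerSubgroup, ∀ v : W.geomTorsion 2, σ • v = v → v = 0 :=
  exists_fpf_mem_kerSubgroup_of_irreducible W κ hp3 two_ne_zero
    (AlignedTransportAtTwoSeed.irr_two_of_forall_not_hasRationalTwoTorsionX W ht)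

/-- **THE `S₃` DATA OF THE COUNTING LEMMA ON THE `Δ < 0` HALF OF THE SEED CELL.** For `E/ℚ` with no rational point of order `2` and
`Δ_E < 0`, and the cyclotomic `ℤ₂`-extension `κ` (`Q := ker κ = Gal(ℚ̄/ℚ_∞)`): there are `σ, τ ∈ Q` and `m₀ ∈ E[2] ∖ 0` with `σ`
fixed-point-free on `E[2]`, `τ m₀ = m₀` and `τ` non-trivial on `E[2]` — exactly the hypotheses `hσ`, `hm₀`, `hτ0`, `hτ` of
`PerfectDescent.natCard_equivariant_S3_bounds` / `KleinCountingTransfer.finite_equivariant_iff_isTorsion_and_muInvariant_eq_zero_S3_of_transfer`.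
So `G_∞ = Gal(ℚ_∞(W[2])/ℚ_∞) ≅ S₃` on the whole `Δ < 0` half-cell (all twelve certified seeds with `Δ < 0`): the `C₃` counting lemma
never applies there. [cite: Serre1972, §5.3] [cite: SilvermanAEC2009, III.1] [cite: Washington1997, §13.1] -/
theorem exists_S3_data_kerSubgroup_of_Δ_neg (κ : ZpExtension ℚ 2) (hκ : κ.IsCyclotomic)
    (ht : ∀ x : ℚ, ¬ HasRationalTwoTorsionX W x) (hΔ : W.Δ < 0) :
    ∃ σ ∈ κ.kerSubgroup, ∃ τ ∈ κ.kerSubgroup, ∃ m₀ : W.geomTorsion 2,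
      (∀ m : W.geomTorsion 2, σ • m = m → m = 0) ∧ m₀ ≠ 0 ∧ τ • m₀ = m₀ ∧ ¬ ∀ m : W.geomTorsion 2, τ • m = m := by
  obtain ⟨σ, hσ, hfpf⟩ := exists_fpf_mem_kerSubgroup_of_forall_not_hasRationalTwoTorsionX W κ (by decide) ht
  obtain ⟨τ, hτ, m₀, v, hm₀, hτm₀, hτv⟩ := exists_transposition_mem_kerSubgroup_of_Δ_neg W κ hΔ hκ
  exact ⟨σ, hσ, τ, hτ, m₀, hfpf, hm₀, hτm₀, fun h ↦ hτv (h v)⟩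

/-- **Both signs: on the whole seed cell `G_∞ ⊇ A₃` and the image of `Γ_ℚ` is all of `Aut(E[2])` as soon as `Δ < 0`** — packaged as:
`ker κ` contains a fixed-point-free element, and (for `Δ_E < 0`) `Γ_ℚ ∋ c₀ ∈ ker κ` acts as a transposition. The remaining datum for
`Δ_E > 0` (is there a transposition in `ker κ`?) is `√Δ_E ∉ ℚ_∞`. [cite: Serre1972, §5.3] [cite: SilvermanAEC2009, III.1] -/
theorem exists_fpf_and_transposition_of_Δ_neg (hp3 : p ≠ 3) (hκ : κ.IsCyclotomic)
    (ht : ∀ x : ℚ, ¬ HasRationalTwoTorsionX W x) (hΔ : W.Δ < 0) :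
    (∃ σ ∈ κ.kerSubgroup, ∀ v : W.geomTorsion 2, σ • v = v → v = 0) ∧
      ∃ τ ∈ κ.kerSubgroup, ∃ m₀ v : W.geomTorsion 2, m₀ ≠ 0 ∧ τ • m₀ = m₀ ∧ τ • v ≠ v :=
  ⟨exists_fpf_mem_kerSubgroup_of_forall_not_hasRationalTwoTorsionX W κ hp3 ht,
    exists_transposition_mem_kerSubgroup_of_Δ_neg W κ hΔ hκ⟩

end Rat

end Summit.BirchSwinnertonDyer.BirchSwinnertonDyer.Theorems.AlignedTransportAtTwoFineRoad.TowerImage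

end
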